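import Literature.Computability.AlgebraicComplexity.BorderRankMatMulThreeHalves
import Literature.Computability.AlgebraicComplexity.AsymptoticSpectrum
import Literature.Computability.AlgebraicComplexity.QuantumFunctionalsUpper
import HarnessLib

/-!
# Occurrence obstructions DO prove border-rank lower bounds for matrix multiplication (Bürgisser–Ikenmeyer, STOC 2013)

Topic `Literature/Computability/AlgebraicComplexity` (geometric complexity theory, tensor setting).
Typed-chain item of the cell `pub-gct-max` (track T, seat lit-2): the statements of
P. Bürgisser, C. Ikenmeyer, *Explicit lower bounds via geometric complexity theory*, STOC 2013,
pp. 141–150 = arXiv:1210.8368 [BurgisserIkenmeyer2013], AS PRINTED, in the tree's vocabulary.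
Honest framing of the cell: multiplicity data and certified rank bounds at small parameters;
occurrence obstructions are ruled out in print for determinant versus padded permanent
(BIP 2019, tree `Literature.Computability.Complexity.no_occurrence_obstructions_holds`) — this file
records the one printed setting where occurrence obstructions DO give a significant lower bound
(border rank of matrix multiplication); nothing here is a claim on VP vs VNP or P vs NP.

## What is printed (numbering of the STOC version = arXiv source `stoc172fp`, theorem counter shared
## with definitions and numbered within sections)

* §2.1: "The *border rank* `R̲(w)` of a tensor `w ∈ W` is defined as the smallest `r ∈ ℕ` such that
  `w` can be obtained as the limit of a sequence `w_k ∈ W` with tensor rank `R(w_k) ≤ r` for all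
  `k`." and (2.1) `MaMu_m := ∑_{i,j,l=1}^m |(i,j)(j,l)(l,i)⟩ ∈ ⊗³ ℂ^{m×m}`; "`R̲(w) ≤ n` iff
  `w ∈ \overline{G E_n}`" (`E_n = ∑ |iii⟩` the unit tensor, `G = GL_n³`).
* §3, Prop. 3.3 (HWV obstructions; in the tree: `HwvIdealProducts.lean`, `HwvIdealDegreeCriterion.lean`)
  and after it: "An *occurence obstruction* against `𝔥 ∈ \overline{G𝔠}` … is a highest weight `λ`
  for `G` such that irreducible `G`-representations of type `λ` do not occur in `ℂ[\overline{G𝔠}]`,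
  but some irreducible `G`-representation of type `λ` does occur in `ℂ[\overline{G𝔥}]`."
  Problem 3.5: "if `𝔥_{m,n} ∉ \overline{G𝔠_n}`, is there an occurence obstruction proving this?"
  (printed as "an important open problem"; for determinant versus padded permanent and
  `n ≥ m^25` the answer is NO by BIP 2019 Thm. 1.4).
* §4.2, Thm. 4.1: obstruction designs `H` of type `λ ⊢*_n d` give highest weight vectors `f_H` of
  weight `λ^*` in `Sym^d ⊗³(ℂ^*)^n`, and they span `HWV_{λ^*}(Sym^d ⊗³(ℂ^*)^n)`.
* §4.3, Prop. 4.2: "Let `H` be an obstruction design of type `λ ⊢*_n d`. Then we have `f_H(w) = 0`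
  for all tensors `w ∈ ⊗³ℂ^n` satisfying `R̲(w) < χ'(H)`." Lemma 4.3: `χ'(H) ≤ 3n − 2`.
* §4.4: `H_κ := {(i,j,k) ∈ [κ+1]³ | i = 1 or j = 1 or k = 1}` ("3-dimensional hook"), of type
  `λ(κ)` = three times the hook partition `(κ+1, 1, …, 1) ⊢_{2κ+1} 3κ+1`, `χ'(H_κ) = 3κ + 1`.
  Lemma 4.4: "There exists a matrix triple `A ∈ (GL_{m²})³` such that `f_{H_κ}(A MaMu_m) ≠ 0`,
  where `κ := (m²−1)/2` for `m > 1` odd."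
  **Thm. 4.5**: "We have `R̲(MaMu_m) ≥ (3/2) m² − 1/2` if `m` is odd. Moreover,
  `R̲(MaMu_m) ≥ (3/2) m² − 2` if `m` is even." (proof of the even case omitted in print).
  Rem. 4.7: "One can prove that `H_κ` is the only obstruction design of type `λ(κ)`. Put `n := 3κ`
  and `d := 3κ + 1`. Proposition 4.2 implies that `f_{H_κ}` vanishes on `\overline{GL_n³ E_n}`.
  Therefore, `mult_{λ(κ)}(ℂ[\overline{GL_n³ E_n}]_d) = 0`. Hence `λ(κ)` is an occurence
  obstruction against `MaMu_m ∈ \overline{GL_n³ E_n}`. Based on the results in [BI:10] we can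
  prove the stronger statement `mult_{λ(κ)}(ℂ[GL_n³ E_n]_d) = 0`, cf. [ike:12b, Prop. 8.3.1]."
* §1: "While this bound is weaker than the one recently obtained by Landsberg and Ottaviani, these
  are the first significant lower bounds obtained within the GCT program."

## What is here

* `burgisserIkenmeyer2013_thm_4_5` — Thm. 4.5 for the tree's border rank `algBorderRank`
  (Bini/Bläser algebraic border rank via polynomial approximate decompositions,
  `SchoenhageTau.lean`; this is the notion in which the tree states every printed border-rank
  bound, e.g. `LandsbergOttaviani2015_algBorderRank_matMulTensor`; over `ℂ` it agrees with the
  topological border rank of BI §2.1 — a theorem-level remark, not used) and the tree's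
  `matMulTensor ℂ m m m` (same `GL³`-orbit as `MaMu_m` up to the order of the three factors).
  Written without `ℕ`-subtraction: `3m² ≤ 2·R̲ + 1` (`m` odd), `3m² ≤ 2·R̲ + 4` (`m` even).
  DISCHARGED (`burgisserIkenmeyer2013_thm_4_5_holds`) from the tree's PROVED Strassen–Lickteig
  bound `three_mul_sq_le_two_mul_algBorderRank_matMulTensor` (`3n² ≤ 2·R̲(⟨n,n,n⟩)`, `n ≥ 2`)
  and `LandsbergOttaviani2015_algBorderRank_matMulTensor` at `n = 1`; as the authors say, the
  numerical bound is not new — its GCT content is the next item.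
* `bi2013Hook κ` — the hook partition `(κ+1, 1^{2κ}) ⊢ 3κ+1`; `burgisserIkenmeyer2013_rem_4_7`
  — NAMED FACT (not discharged): for odd `m ≥ 3` and `2κ + 1 = m²`, the triple
  `λ(κ) = (hook, hook, hook)` does NOT occur in degree `d = 3κ+1` of the coordinate ring of
  `\overline{GL³ · ⟨3κ⟩}` (tensors of border rank `≤ 3κ`) and DOES occur in degree `d` of the
  coordinate ring of `\overline{GL³ · ⟨m,m,m⟩}` — i.e. `λ(κ)` is an occurrence obstruction
  against `R̲(⟨m,m,m⟩) ≤ 3κ = (3m² − 3)/2` (Rem. 4.7 with Prop. 4.2, Lemma 4.4, Thm. 4.1).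
  Occurrence of a type `λ = (λ⁰, λ¹, λ²) ⊢ d` in `𝒪(\overline{GL³ · t})_d` is written, as in
  `UnitTensorMomentPolytope.lean` / `IsotypicPressure.lean` (`OccursIn`), by non-vanishing of the
  triple isotypic character sum `isotypicSum₁ λ⁰ (isotypicSum₂ λ¹ (isotypicSum₃ λ² t^{⊗d}))`
  (`QuantumFunctionalsUpper.lean`; a non-zero multiple of the `GL³`-isotypic projection of
  `t^{⊗d}`, whose non-vanishing is "`V_λ(G)^*` occurs in `𝒪(\overline{Gt})_d`", Bürgisser–Ikenmeyer
  2011 Def. 3.1, by Schur–Weyl duality and `𝒪(\overline{Gt})_d ≅ ⟨G · t^{⊗d}⟩^*` — the standing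
  identification of those files, not re-proved here). The triple `λ(κ)` is symmetric, so the
  order of the three tensor factors is immaterial.

## Deliberately NOT here

Obstruction designs, `f_H`, the chromatic index and Thm. 4.1 / Prop. 4.2 / Lemma 4.3 / Cor. 4.8
(`k(λ) ≤ N(λ)`) / Prop. 4.9 (NP-completeness of existence of a design of given type) as separate
statements (they need the polarisation machinery of §5; the tree's `PlethysmTableauEvaluation.lean`,
`HwvEvaluationRankBound.lean` cover the polynomial scenario only); the orbit (non-closure)
strengthening `mult_{λ(κ)}(ℂ[GL_n³E_n]_d) = 0` of Rem. 4.7; §4.6 (determinantal complexity,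
criterion `pl_λ(d[n]) > sk(n×d; λ)` — in the tree: `HwvIdealRankBound.lean`,
`PerDetExactMultiplicities.lean`).
-/

noncomputable section

namespace Literature.Computability.AlgebraicComplexity

/-! ### Theorem 4.5: the border-rank bound -/

/-- **Bürgisser–Ikenmeyer 2013, Thm. 4.5** (verbatim: "We have `R̲(MaMu_m) ≥ (3/2) m² − 1/2` if
`m` is odd. Moreover, `R̲(MaMu_m) ≥ (3/2) m² − 2` if `m` is even."), for `m ≥ 1`, the tree's
border rank `algBorderRank` and matrix multiplication tensor `matMulTensor ℂ m m m = ⟨m,m,m⟩`,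
cleared of denominators and of `ℕ`-subtraction: `3m² ≤ 2·R̲(⟨m,m,m⟩) + 1` for odd `m` and
`3m² ≤ 2·R̲(⟨m,m,m⟩) + 4` for even `m`. Obtained in print from occurrence obstructions
(`burgisserIkenmeyer2013_rem_4_7`); discharged below from the tree's Strassen–Lickteig bound.
[cite: BurgisserIkenmeyer2013, Thm. 4.5] -/
def burgisserIkenmeyer2013_thm_4_5 : Prop :=
  ∀ m : ℕ, 1 ≤ m →
    (Odd m → 3 * m ^ 2 ≤ 2 * algBorderRank (matMulTensor ℂ m m m) + 1) ∧
      (Even m → 3 * m ^ 2 ≤ 2 * algBorderRank (matMulTensor ℂ m m m) + 4)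

/-- Discharge of `burgisserIkenmeyer2013_thm_4_5`: for `m ≥ 2` both clauses follow from the proved
`3m² ≤ 2·R̲(⟨m,m,m⟩)` (`three_mul_sq_le_two_mul_algBorderRank_matMulTensor`, BCS 1997 Cor. (19.14));
for `m = 1` from `1 ≤ R̲(⟨1,1,1⟩)` (`LandsbergOttaviani2015_algBorderRank_matMulTensor`). As the
source says (§1), the bound is "slightly below the one by Strassen and Lickteig".
[cite: BurgisserIkenmeyer2013, Thm. 4.5] -/
theorem burgisserIkenmeyer2013_thm_4_5_holds : burgisserIkenmeyer2013_thm_4_5 := by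
  intro m hm
  rcases Nat.lt_or_ge m 2 with hlt | hge
  · obtain rfl : m = 1 := le_antisymm (Nat.le_of_lt_succ hlt) hm
    refine ⟨fun _ => ?_, fun h1 => absurd h1 Nat.not_even_one⟩
    have h1 : 1 ≤ algBorderRank (matMulTensor ℂ 1 1 1) := by
      simpa using LandsbergOttaviani2015_algBorderRank_matMulTensor ℂ 1 le_rfl
    have h3 : 3 * 1 ^ 2 = 3 := by norm_num
    rw [h3]
    omega
  · have h3 := three_mul_sq_le_two_mul_algBorderRank_matMulTensor ℂ m hge
    have hsq : 3 * m ^ 2 = 3 * m * m := by ring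
    exact ⟨fun _ => (hsq.le.trans h3).trans (Nat.le_add_right _ _),
      fun _ => (hsq.le.trans h3).trans (Nat.le_add_right _ _)⟩

/-! ### Remark 4.7: `λ(κ)` is an occurrence obstruction -/

/-- The hook partition `(κ+1, 1, …, 1) ⊢ 3κ+1` with `2κ+1` parts — one component of the type
`λ(κ)` of the "3-dimensional hook" obstruction design `H_κ` (BI 2013, §4.4: "Its type `λ(κ)` is the
triple with components three times the hook partition `(κ+1,1,…,1) ⊢_{2κ+1} 3κ+1`"). Built with
`Nat.Partition.ofSums`. [cite: BurgisserIkenmeyer2013, §4.4 (before Lemma 4.4)] -/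
def bi2013Hook (κ : ℕ) : Nat.Partition (3 * κ + 1) :=
  Nat.Partition.ofSums _ ({κ + 1} + Multiset.replicate (2 * κ) 1) (by
    rw [Multiset.sum_add, Multiset.sum_singleton, Multiset.sum_replicate, smul_eq_mul]
    ring)

/-- The parts of `bi2013Hook κ` are `κ+1` and `2κ` ones. [cite: BurgisserIkenmeyer2013, §4.4 (before Lemma 4.4)] -/
theorem bi2013Hook_parts (κ : ℕ) :
    (bi2013Hook κ).parts = {κ + 1} + Multiset.replicate (2 * κ) 1 := by
  rw [bi2013Hook, Nat.Partition.ofSums_parts, Multiset.filter_eq_self]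
  intro a ha
  simp only [Multiset.mem_add, Multiset.mem_singleton, Multiset.mem_replicate] at ha
  omega

/-- `bi2013Hook κ` has exactly `2κ + 1` parts (so `λ(κ) ⊢*_n 3κ+1` as soon as `2κ + 1 ≤ n`).
[cite: BurgisserIkenmeyer2013, §4.4 (before Lemma 4.4)] -/
theorem card_parts_bi2013Hook (κ : ℕ) : (bi2013Hook κ).parts.card = 2 * κ + 1 := by
  rw [bi2013Hook_parts, Multiset.card_add, Multiset.card_singleton, Multiset.card_replicate]
  omega

/-- NAMED FACT (**Bürgisser–Ikenmeyer 2013, Rem. 4.7 with Prop. 4.2, Lemma 4.4 and Thm. 4.1**; not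
discharged). For odd `m ≥ 3` and `κ` with `2κ + 1 = m²`, put `n := 3κ`, `d := 3κ + 1` and let
`λ(κ) = (hook, hook, hook)`, `hook = (κ+1, 1^{2κ})` (`bi2013Hook κ`). Printed: "Proposition 4.2
implies that `f_{H_κ}` vanishes on `\overline{GL_n³ E_n}`. Therefore,
`mult_{λ(κ)}(ℂ[\overline{GL_n³ E_n}]_d) = 0`. Hence `λ(κ)` is an occurence obstruction against
`MaMu_m ∈ \overline{GL_n³ E_n}`" (Rem. 4.7; the occurrence on the matrix-multiplication side is
Lemma 4.4, "There exists a matrix triple `A ∈ (GL_{m²})³` such that `f_{H_κ}(A MaMu_m) ≠ 0`, where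
`κ := (m²−1)/2` for `m > 1` odd", with Thm. 4.1, `f_{H_κ}` a highest weight vector of weight
`λ(κ)^*`). Rendered with the tree's occurrence test (module docstring): the triple isotypic
character sum of type `λ(κ)` KILLS the `d`-th tensor power of the unit tensor
`⟨n⟩ = unitTensor ℂ (3κ)` (type `λ(κ)` does not occur in `𝒪(\overline{GL³·⟨n⟩})_d`, the closure
form printed in Rem. 4.7 — the orbit form `ℂ[GL_n³E_n]_d` is not asserted) and does NOT kill the
`d`-th tensor power of `⟨m,m,m⟩ = matMulTensor ℂ m m m` (type `λ(κ)` occurs in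
`𝒪(\overline{GL³·⟨m,m,m⟩})_d`; format `(m²)³`, `ℓ(hook) = 2κ+1 = m²`; occurrence does not
depend on the ambient format, Bürgisser–Ikenmeyer 2011 Prop. 3.3). By Schur's lemma this is an
occurrence obstruction against `R̲(⟨m,m,m⟩) ≤ 3κ`, giving the odd case of Thm. 4.5.
[cite: BurgisserIkenmeyer2013, Rem. 4.7 (with Prop. 4.2, Lemma 4.4, Thm. 4.1)] -/
def burgisserIkenmeyer2013_rem_4_7 : Prop :=
  ∀ (m κ : ℕ), Odd m → 3 ≤ m → 2 * κ + 1 = m ^ 2 →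
    isotypicSum₁ (bi2013Hook κ) (isotypicSum₂ (bi2013Hook κ) (isotypicSum₃ (bi2013Hook κ)
        (kroneckerPow (unitTensor ℂ (3 * κ)) (3 * κ + 1)))) = 0 ∧
      isotypicSum₁ (bi2013Hook κ) (isotypicSum₂ (bi2013Hook κ) (isotypicSum₃ (bi2013Hook κ)
          (kroneckerPow (matMulTensor ℂ m m m) (3 * κ + 1)))) ≠ 0

end Literature.Computability.AlgebraicComplexity
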